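import Summits.ValiantsHypothesis.ValiantsHypothesis.Theorems.LacunarySymmetroidMatrixDescartesPivotRankOneOneThreeKillEightOdd
import Summits.ValiantsHypothesis.ValiantsHypothesis.Theorems.LacunarySymmetroidMatrixDescartesPivotRankOneOneThreeSupportKit2
import Summits.ValiantsHypothesis.ValiantsHypothesis.Theorems.LacunarySymmetroidMatrixDescartesPivotRankOneTwoTwoSupportKit
import Summits.ValiantsHypothesis.ValiantsHypothesis.Theorems.LacunarySymmetroidMatrixDescartesPivotRankOneCriticalWindowsOneSidedSevenExact

/-!
# `MatrixDescartes` census — rank-one `(2,4)₁`: THE PARAMETRIC FRAME OF THE SUPPORT CERTIFICATES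
# (symbolic support `(e; d₀, d₁, d₂, d₃)`: «never Descartes-sharp ⇒ law value», and «chord bounds from sharpness ⇒ law value», both splits)

HONEST FRAMING.  Object-search cell `pub-symmetroid`, seat `val-sym-mdr-p1` (generation 26); helper file `--supports` the crux item
stmt-ValiantsHypothesis-18050 (`Theses.LacunarySymmetroid.MatrixDescartes`, OPEN, on HOLD) with NO closure claim.  The desk's preferred object
(R3320 SCALE RULING): the support-by-support certificates of the rank-one law «(2,4)₁ ≤ 8» (chamber (C) of `1|3`: `…OneThreeSupport<TAG>Seven`;
chamber (B) of `2|2`: `…TwoTwoSupport<TAG>Eight`) share everything except the six row inequalities and three numeric comparisons; this file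
types the shared part ONCE over a SYMBOLIC support.  §1 (`1|3`, `d₀ < e < d₁ < d₂ < d₃`, all-core hyperbolic normal form `J = [[0,1],[1,0]]`,
letters `wₖ(1,tₖ)(1,tₖ)ᵀ`): `oneThree_card_le_seven_of_countP_le_eight` (odd parity: «≤ 8 with multiplicity ⇒ ≤ 7 distinct»),
`oneThree_pivotPosRoots_le_seven_of_countP_le_eight` (census currency, symbolic matrix unrolling), and the chord frames
`oneThree_pivotPosRoots_le_seven_of_chords` / `…_of_chords_sharp`: if nine roots with multiplicity force the three chord bounds
`KA·t₀t₁ ≤ (t₀−t₁)²`, `(t₁−t₂)² ≤ KB·t₁t₂`, `KC·(t₀−t₁)²t₂ ≤ (t₀−t₂)²t₁` for constants under the side conditions of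
`chord_contradiction_free` (resp. `chord_contradiction_sharp`), then `pivotPosRoots e d J (letters) ≤ 7`.  §2 (`2|2`, `d₀ < d₁ < e < d₂ < d₃`):
the even-parity twins `twoTwo_card_le_eight_of_countP_le_nine`, `twoTwo_pivotPosRoots_le_eight_of_countP_le_nine`,
`twoTwo_pivotPosRoots_le_eight_of_chords` (chords on letters `1,2,3`, sharp kit).  With this frame a per-support certificate is its Rows file plus
the logarithmic derivation of the three chord bounds.  The chamber-wide law is NOT claimed (the ray constants are support-dependent and their
margins vanish at faces of the chambers — seat memo §5).  Nothing here bears on `MatrixDescartes` in its window, on `DoorA26` / `DoorA34`,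
registers / credences, or `VP ≠ VNP`.

[folklore] Descartes' parity [cite: BasuPollackRoy2006, Thm. 2.33] through the tree; the tree's rank-one determinant expansion
(`det_rankOne_four_sum`, `pencil_four_unroll`); the chord lemmas.  No definitions, no named facts.
-/

-- `Summit.ValiantsHypothesis.ValiantsHypothesis.…` repeats a component by the D-0017 layout
-- (single-conjunct summit), which the `dupNamespace` linter flags; the name is mandated.
set_option linter.dupNamespace false

namespace Summit.ValiantsHypothesis.ValiantsHypothesis.Theorems.LacunarySymmetroidMatrixDescartes.Pivot.TwoDirections.BlockLaw

open Polynomial Matrix Finset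
open scoped BigOperators
open Summit.ValiantsHypothesis.ValiantsHypothesis.Theorems.LacunarySymmetroidMatrixDescartes.Pivot (pivotPosRoots)
open Summit.ValiantsHypothesis.ValiantsHypothesis.Theorems.LacunarySymmetroidMatrixDescartes.Pivot.KillMult (card_posRoots_le_pred_of_odd)
open Summit.ValiantsHypothesis.ValiantsHypothesis.Theorems.LacunarySymmetroidMatrixDescartes.Pivot.CriticalWindows.OneSidedSeven
  (pencil_four_unroll)

/-! ## 1. The `1|3` split (`d₀ < e < d₁ < d₂ < d₃`): odd parity, law value `7` -/

/-- **`1|3`: at most eight positive roots with multiplicity ⇒ at most seven distinct** (all-core hyperbolic normal form; `w₀, w₂, w₃ > 0`,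
`t₀ > 0`, letters `2, 3` not parallel make the trailing coefficient `−2w₀t₀ < 0` and the leading one `w₂w₃(t₂−t₃)² > 0`, so the count is odd). -/
theorem oneThree_card_le_seven_of_countP_le_eight (e d₀ d₁ d₂ d₃ : ℕ) (h0e : d₀ < e) (he1 : e < d₁) (h12 : d₁ < d₂) (h23 : d₂ < d₃)
    (w₀ w₁ w₂ w₃ t₀ t₁ t₂ t₃ : ℝ) (hw₀ : 0 < w₀) (hw₂ : 0 < w₂) (hw₃ : 0 < w₃) (ht₀ : 0 < t₀) (h23' : t₂ ≠ t₃)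
    (h8 : (∑ i : Fin 11, Polynomial.C ((![(-1 : ℝ), w₀ * -(2 * t₀), w₁ * -(2 * t₁), w₂ * -(2 * t₂), w₃ * -(2 * t₃), w₀ * w₁ * (t₀ - t₁) ^ 2, w₀ * w₂ * (t₀ - t₂) ^ 2, w₀ * w₃ * (t₀ - t₃) ^ 2, w₁ * w₂ * (t₁ - t₂) ^ 2, w₁ * w₃ * (t₁ - t₃) ^ 2, w₂ * w₃ * (t₂ - t₃) ^ 2] : Fin 11 → ℝ) i) * X ^ ((![2 * e, e + d₀, e + d₁, e + d₂, e + d₃, d₀ + d₁, d₀ + d₂, d₀ + d₃, d₁ + d₂, d₁ + d₃, d₂ + d₃] : Fin 11 → ℕ) i)).roots.countP (fun x => 0 < x) ≤ 8) :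
    ((∑ i : Fin 11, Polynomial.C ((![(-1 : ℝ), w₀ * -(2 * t₀), w₁ * -(2 * t₁), w₂ * -(2 * t₂), w₃ * -(2 * t₃), w₀ * w₁ * (t₀ - t₁) ^ 2, w₀ * w₂ * (t₀ - t₂) ^ 2, w₀ * w₃ * (t₀ - t₃) ^ 2, w₁ * w₂ * (t₁ - t₂) ^ 2, w₁ * w₃ * (t₁ - t₃) ^ 2, w₂ * w₃ * (t₂ - t₃) ^ 2] : Fin 11 → ℝ) i) * X ^ ((![2 * e, e + d₀, e + d₁, e + d₂, e + d₃, d₀ + d₁, d₀ + d₂, d₀ + d₃, d₁ + d₂, d₁ + d₃, d₂ + d₃] : Fin 11 → ℕ) i)).roots.toFinset.filter (fun t => 0 < t)).card ≤ 7 := by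
  have hD23 : 0 < (t₂ - t₃) ^ 2 := by have := sub_ne_zero.2 h23'; positivity
  have htrail : w₀ * -(2 * t₀) < 0 := by have := mul_pos hw₀ ht₀; linarith
  have hodd := elevenNomial_oneThree_odd e d₀ d₁ d₂ d₃ h0e he1 h12 h23
    (-1) (-(2 * t₀)) (-(2 * t₁)) (-(2 * t₂)) (-(2 * t₃)) w₀ w₁ w₂ w₃ ((t₀ - t₁) ^ 2) ((t₀ - t₂) ^ 2) ((t₀ - t₃) ^ 2) ((t₁ - t₂) ^ 2)
    ((t₁ - t₃) ^ 2) ((t₂ - t₃) ^ 2) htrail (by positivity)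
  have h7 := card_posRoots_le_pred_of_odd _ 4 hodd (by omega)
  omega

/-- **`1|3`, matrix form**: `countP ≤ 8` for the expanded eleven-nomial ⇒ the rank-one pencil's determinant has `≤ 7` distinct positive roots. -/
theorem oneThree_rankOne_le_seven_of_countP_le_eight (e d₀ d₁ d₂ d₃ : ℕ) (h0e : d₀ < e) (he1 : e < d₁) (h12 : d₁ < d₂) (h23 : d₂ < d₃)
    (w₀ w₁ w₂ w₃ t₀ t₁ t₂ t₃ : ℝ) (hw₀ : 0 < w₀) (hw₂ : 0 < w₂) (hw₃ : 0 < w₃) (ht₀ : 0 < t₀) (h23' : t₂ ≠ t₃)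
    (h8 : (∑ i : Fin 11, Polynomial.C ((![(-1 : ℝ), w₀ * -(2 * t₀), w₁ * -(2 * t₁), w₂ * -(2 * t₂), w₃ * -(2 * t₃), w₀ * w₁ * (t₀ - t₁) ^ 2, w₀ * w₂ * (t₀ - t₂) ^ 2, w₀ * w₃ * (t₀ - t₃) ^ 2, w₁ * w₂ * (t₁ - t₂) ^ 2, w₁ * w₃ * (t₁ - t₃) ^ 2, w₂ * w₃ * (t₂ - t₃) ^ 2] : Fin 11 → ℝ) i) * X ^ ((![2 * e, e + d₀, e + d₁, e + d₂, e + d₃, d₀ + d₁, d₀ + d₂, d₀ + d₃, d₁ + d₂, d₁ + d₃, d₂ + d₃] : Fin 11 → ℕ) i)).roots.countP (fun x => 0 < x) ≤ 8) :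
    ((Matrix.det (((X : ℝ[X]) ^ e) • (!![(0 : ℝ), 1; 1, 0] : Matrix (Fin 2) (Fin 2) ℝ).map Polynomial.C
        + (Polynomial.C w₀ * X ^ d₀) • (vecMulVec ![1, t₀] ![1, t₀]).map Polynomial.C
        + (Polynomial.C w₁ * X ^ d₁) • (vecMulVec ![1, t₁] ![1, t₁]).map Polynomial.C
        + (Polynomial.C w₂ * X ^ d₂) • (vecMulVec ![1, t₂] ![1, t₂]).map Polynomial.C
        + (Polynomial.C w₃ * X ^ d₃) • (vecMulVec ![1, t₃] ![1, t₃]).map Polynomial.C)).roots.toFinset.filter (fun t => 0 < t)).card ≤ 7 := by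
  rw [det_rankOne_four_sum]
  have e0 : (!![(0 : ℝ), 1; 1, 0] : Matrix (Fin 2) (Fin 2) ℝ).det = -1 := by
    simp [Matrix.det_fin_two]
  have em : ∀ s r : ℝ, r * ((!![(0 : ℝ), 1; 1, 0] : Matrix (Fin 2) (Fin 2) ℝ) 0 0 * (![1, s] : Fin 2 → ℝ) 1 ^ 2
      + (!![(0 : ℝ), 1; 1, 0] : Matrix (Fin 2) (Fin 2) ℝ) 1 1 * (![1, s] : Fin 2 → ℝ) 0 ^ 2
      - ((!![(0 : ℝ), 1; 1, 0] : Matrix (Fin 2) (Fin 2) ℝ) 0 1 + (!![(0 : ℝ), 1; 1, 0] : Matrix (Fin 2) (Fin 2) ℝ) 1 0)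
        * ((![1, s] : Fin 2 → ℝ) 0 * (![1, s] : Fin 2 → ℝ) 1)) = r * -(2 * s) := by
    intro s r
    have : ((!![(0 : ℝ), 1; 1, 0] : Matrix (Fin 2) (Fin 2) ℝ) 0 0 * (![1, s] : Fin 2 → ℝ) 1 ^ 2
      + (!![(0 : ℝ), 1; 1, 0] : Matrix (Fin 2) (Fin 2) ℝ) 1 1 * (![1, s] : Fin 2 → ℝ) 0 ^ 2
      - ((!![(0 : ℝ), 1; 1, 0] : Matrix (Fin 2) (Fin 2) ℝ) 0 1 + (!![(0 : ℝ), 1; 1, 0] : Matrix (Fin 2) (Fin 2) ℝ) 1 0)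
        * ((![1, s] : Fin 2 → ℝ) 0 * (![1, s] : Fin 2 → ℝ) 1)) = -(2 * s) := by
      simp only [Matrix.of_apply, Matrix.cons_val', Matrix.cons_val_zero, Matrix.cons_val_one, Matrix.empty_val',
        Matrix.cons_val_fin_one]
      ring
    rw [this]
  have eD : ∀ s r c : ℝ, c * (((![1, s] : Fin 2 → ℝ) 0 * (![1, r] : Fin 2 → ℝ) 1 - (![1, s] : Fin 2 → ℝ) 1 * (![1, r] : Fin 2 → ℝ) 0) ^ 2)
      = c * (s - r) ^ 2 := by
    intro s r c
    have : ((![1, s] : Fin 2 → ℝ) 0 * (![1, r] : Fin 2 → ℝ) 1 - (![1, s] : Fin 2 → ℝ) 1 * (![1, r] : Fin 2 → ℝ) 0) ^ 2 = (s - r) ^ 2 := by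
      simp only [Matrix.cons_val_zero, Matrix.cons_val_one]
      ring
    rw [this]
  simp only [e0, em, eD]
  exact oneThree_card_le_seven_of_countP_le_eight e d₀ d₁ d₂ d₃ h0e he1 h12 h23 w₀ w₁ w₂ w₃ t₀ t₁ t₂ t₃ hw₀ hw₂ hw₃ ht₀ h23' h8

/-- **`1|3`, census currency**: `countP ≤ 8` for the expanded eleven-nomial of the letters `w k • (1, t k)(1, t k)ᵀ` ⇒
`pivotPosRoots e ![d₀, d₁, d₂, d₃] [[0,1],[1,0]] (letters) ≤ 7`. -/
theorem oneThree_pivotPosRoots_le_seven_of_countP_le_eight (e d₀ d₁ d₂ d₃ : ℕ) (h0e : d₀ < e) (he1 : e < d₁) (h12 : d₁ < d₂)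
    (h23 : d₂ < d₃) (w t : Fin 4 → ℝ) (hw₀ : 0 < w 0) (hw₂ : 0 < w 2) (hw₃ : 0 < w 3) (ht₀ : 0 < t 0) (h23' : t 2 ≠ t 3)
    (h8 : (∑ i : Fin 11, Polynomial.C ((![(-1 : ℝ), w 0 * -(2 * t 0), w 1 * -(2 * t 1), w 2 * -(2 * t 2), w 3 * -(2 * t 3), w 0 * w 1 * (t 0 - t 1) ^ 2, w 0 * w 2 * (t 0 - t 2) ^ 2, w 0 * w 3 * (t 0 - t 3) ^ 2, w 1 * w 2 * (t 1 - t 2) ^ 2, w 1 * w 3 * (t 1 - t 3) ^ 2, w 2 * w 3 * (t 2 - t 3) ^ 2] : Fin 11 → ℝ) i) * X ^ ((![2 * e, e + d₀, e + d₁, e + d₂, e + d₃, d₀ + d₁, d₀ + d₂, d₀ + d₃, d₁ + d₂, d₁ + d₃, d₂ + d₃] : Fin 11 → ℕ) i)).roots.countP (fun x => 0 < x) ≤ 8) :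
    pivotPosRoots e (![d₀, d₁, d₂, d₃] : Fin 4 → ℕ) (!![(0 : ℝ), 1; 1, 0] : Matrix (Fin 2) (Fin 2) ℝ) (fun k => w k • vecMulVec ![1, t k] ![1, t k]) ≤ 7 := by
  unfold pivotPosRoots
  rw [pencil_four_unroll]
  have h := oneThree_rankOne_le_seven_of_countP_le_eight e d₀ d₁ d₂ d₃ h0e he1 h12 h23 (w 0) (w 1) (w 2) (w 3) (t 0) (t 1) (t 2) (t 3)
    hw₀ hw₂ hw₃ ht₀ h23' h8
  simpa using h

/-- **★ `1|3` CHORD FRAME**: if nine positive roots with multiplicity of the expanded eleven-nomial force the three chord bounds on letters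
`0, 1, 2` with constants under the side conditions of `chord_contradiction_free`, then `pivotPosRoots ≤ 7` for those letters.
(The per-support certificates discharge the hypothesis `hch` from six rows of sharpness by logarithms.) -/
theorem oneThree_pivotPosRoots_le_seven_of_chords (e d₀ d₁ d₂ d₃ : ℕ) (h0e : d₀ < e) (he1 : e < d₁) (h12 : d₁ < d₂) (h23 : d₂ < d₃)
    (KA KB KC R ρ : ℝ) (hKA : 0 < KA) (hR : 1 ≤ R) (hRA : (R - 1) ^ 2 ≤ KA * R) (hρ : 1 ≤ ρ) (hρB : KB * ρ ≤ (ρ - 1) ^ 2)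
    (hKC : ρ ^ 3 * R ^ 2 < KC * (R - 1) ^ 2)
    (w t : Fin 4 → ℝ) (hw₀ : 0 < w 0) (hw₂ : 0 < w 2) (hw₃ : 0 < w 3) (ht₀ : 0 < t 0) (ht₁ : 0 < t 1) (ht₂ : 0 < t 2) (h23' : t 2 ≠ t 3)
    (hch : 9 ≤ (∑ i : Fin 11, Polynomial.C ((![(-1 : ℝ), w 0 * -(2 * t 0), w 1 * -(2 * t 1), w 2 * -(2 * t 2), w 3 * -(2 * t 3), w 0 * w 1 * (t 0 - t 1) ^ 2, w 0 * w 2 * (t 0 - t 2) ^ 2, w 0 * w 3 * (t 0 - t 3) ^ 2, w 1 * w 2 * (t 1 - t 2) ^ 2, w 1 * w 3 * (t 1 - t 3) ^ 2, w 2 * w 3 * (t 2 - t 3) ^ 2] : Fin 11 → ℝ) i) * X ^ ((![2 * e, e + d₀, e + d₁, e + d₂, e + d₃, d₀ + d₁, d₀ + d₂, d₀ + d₃, d₁ + d₂, d₁ + d₃, d₂ + d₃] : Fin 11 → ℕ) i)).roots.countP (fun x => 0 < x) →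
      KA * (t 0 * t 1) ≤ (t 0 - t 1) ^ 2 ∧ (t 1 - t 2) ^ 2 ≤ KB * (t 1 * t 2) ∧ KC * ((t 0 - t 1) ^ 2 * t 2) ≤ (t 0 - t 2) ^ 2 * t 1) :
    pivotPosRoots e (![d₀, d₁, d₂, d₃] : Fin 4 → ℕ) (!![(0 : ℝ), 1; 1, 0] : Matrix (Fin 2) (Fin 2) ℝ) (fun k => w k • vecMulVec ![1, t k] ![1, t k]) ≤ 7 := by
  refine oneThree_pivotPosRoots_le_seven_of_countP_le_eight e d₀ d₁ d₂ d₃ h0e he1 h12 h23 w t hw₀ hw₂ hw₃ ht₀ h23' ?_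
  by_contra h9
  push Not at h9
  obtain ⟨hA, hB, hC⟩ := hch (by omega)
  exact chord_contradiction_free (t 0) (t 1) (t 2) KA KB KC R ρ ht₀ ht₁ ht₂ hKA hR hRA hρ hρB hKC hA hB hC

/-- **`1|3` CHORD FRAME, sharp constants** (`ρ ≤ R` and `ρ·R² < KC·(R−1)²`, via `chord_contradiction_sharp`). -/
theorem oneThree_pivotPosRoots_le_seven_of_chords_sharp (e d₀ d₁ d₂ d₃ : ℕ) (h0e : d₀ < e) (he1 : e < d₁) (h12 : d₁ < d₂)
    (h23 : d₂ < d₃) (KA KB KC R ρ : ℝ) (hKA : 0 < KA) (hR : 1 ≤ R) (hRA : (R - 1) ^ 2 ≤ KA * R) (hρ : 1 ≤ ρ)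
    (hρB : KB * ρ ≤ (ρ - 1) ^ 2) (hρR : ρ ≤ R) (hKC : ρ * R ^ 2 < KC * (R - 1) ^ 2)
    (w t : Fin 4 → ℝ) (hw₀ : 0 < w 0) (hw₂ : 0 < w 2) (hw₃ : 0 < w 3) (ht₀ : 0 < t 0) (ht₁ : 0 < t 1) (ht₂ : 0 < t 2) (h23' : t 2 ≠ t 3)
    (hch : 9 ≤ (∑ i : Fin 11, Polynomial.C ((![(-1 : ℝ), w 0 * -(2 * t 0), w 1 * -(2 * t 1), w 2 * -(2 * t 2), w 3 * -(2 * t 3), w 0 * w 1 * (t 0 - t 1) ^ 2, w 0 * w 2 * (t 0 - t 2) ^ 2, w 0 * w 3 * (t 0 - t 3) ^ 2, w 1 * w 2 * (t 1 - t 2) ^ 2, w 1 * w 3 * (t 1 - t 3) ^ 2, w 2 * w 3 * (t 2 - t 3) ^ 2] : Fin 11 → ℝ) i) * X ^ ((![2 * e, e + d₀, e + d₁, e + d₂, e + d₃, d₀ + d₁, d₀ + d₂, d₀ + d₃, d₁ + d₂, d₁ + d₃, d₂ + d₃] : Fin 11 → ℕ) i)).roots.countP (fun x => 0 < x) →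
      KA * (t 0 * t 1) ≤ (t 0 - t 1) ^ 2 ∧ (t 1 - t 2) ^ 2 ≤ KB * (t 1 * t 2) ∧ KC * ((t 0 - t 1) ^ 2 * t 2) ≤ (t 0 - t 2) ^ 2 * t 1) :
    pivotPosRoots e (![d₀, d₁, d₂, d₃] : Fin 4 → ℕ) (!![(0 : ℝ), 1; 1, 0] : Matrix (Fin 2) (Fin 2) ℝ) (fun k => w k • vecMulVec ![1, t k] ![1, t k]) ≤ 7 := by
  refine oneThree_pivotPosRoots_le_seven_of_countP_le_eight e d₀ d₁ d₂ d₃ h0e he1 h12 h23 w t hw₀ hw₂ hw₃ ht₀ h23' ?_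
  by_contra h9
  push Not at h9
  obtain ⟨hA, hB, hC⟩ := hch (by omega)
  exact chord_contradiction_sharp (t 0) (t 1) (t 2) KA KB KC R ρ ht₀ ht₁ ht₂ hKA hR hRA hρ hρB hρR hKC hA hB hC

/-! ## 2. The `2|2` split (`d₀ < d₁ < e < d₂ < d₃`): even parity, law value `8` -/

/-- **`2|2`: at most nine positive roots with multiplicity ⇒ at most eight distinct** (trailing coefficient `w₀w₁(t₀−t₁)² > 0`, leading
`w₂w₃(t₂−t₃)² > 0`, so the count is even). -/
theorem twoTwo_card_le_eight_of_countP_le_nine (e d₀ d₁ d₂ d₃ : ℕ) (h01 : d₀ < d₁) (h1e : d₁ < e) (he2 : e < d₂) (h23 : d₂ < d₃)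
    (w₀ w₁ w₂ w₃ t₀ t₁ t₂ t₃ : ℝ) (hw₀ : 0 < w₀) (hw₁ : 0 < w₁) (hw₂ : 0 < w₂) (hw₃ : 0 < w₃) (h01' : t₀ ≠ t₁) (h23' : t₂ ≠ t₃)
    (h9 : (∑ i : Fin 11, Polynomial.C ((![(-1 : ℝ), w₀ * -(2 * t₀), w₁ * -(2 * t₁), w₂ * -(2 * t₂), w₃ * -(2 * t₃), w₀ * w₁ * (t₀ - t₁) ^ 2, w₀ * w₂ * (t₀ - t₂) ^ 2, w₀ * w₃ * (t₀ - t₃) ^ 2, w₁ * w₂ * (t₁ - t₂) ^ 2, w₁ * w₃ * (t₁ - t₃) ^ 2, w₂ * w₃ * (t₂ - t₃) ^ 2] : Fin 11 → ℝ) i) * X ^ ((![2 * e, e + d₀, e + d₁, e + d₂, e + d₃, d₀ + d₁, d₀ + d₂, d₀ + d₃, d₁ + d₂, d₁ + d₃, d₂ + d₃] : Fin 11 → ℕ) i)).roots.countP (fun x => 0 < x) ≤ 9) :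
    ((∑ i : Fin 11, Polynomial.C ((![(-1 : ℝ), w₀ * -(2 * t₀), w₁ * -(2 * t₁), w₂ * -(2 * t₂), w₃ * -(2 * t₃), w₀ * w₁ * (t₀ - t₁) ^ 2, w₀ * w₂ * (t₀ - t₂) ^ 2, w₀ * w₃ * (t₀ - t₃) ^ 2, w₁ * w₂ * (t₁ - t₂) ^ 2, w₁ * w₃ * (t₁ - t₃) ^ 2, w₂ * w₃ * (t₂ - t₃) ^ 2] : Fin 11 → ℝ) i) * X ^ ((![2 * e, e + d₀, e + d₁, e + d₂, e + d₃, d₀ + d₁, d₀ + d₂, d₀ + d₃, d₁ + d₂, d₁ + d₃, d₂ + d₃] : Fin 11 → ℕ) i)).roots.toFinset.filter (fun t => 0 < t)).card ≤ 8 := by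
  have hD01 : 0 < (t₀ - t₁) ^ 2 := by have := sub_ne_zero.2 h01'; positivity
  have hD23 : 0 < (t₂ - t₃) ^ 2 := by have := sub_ne_zero.2 h23'; positivity
  have heven := elevenNomial_twoTwo_even e d₀ d₁ d₂ d₃ h01 h1e he2 h23
    (-1) (-(2 * t₀)) (-(2 * t₁)) (-(2 * t₂)) (-(2 * t₃)) w₀ w₁ w₂ w₃ ((t₀ - t₁) ^ 2) ((t₀ - t₂) ^ 2) ((t₀ - t₃) ^ 2) ((t₁ - t₂) ^ 2)
    ((t₁ - t₃) ^ 2) ((t₂ - t₃) ^ 2) (by positivity) (by positivity)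
  have h8 := card_posRoots_le_of_even _ 4 heven (by omega)
  omega

/-- **`2|2`, matrix form**: `countP ≤ 9` for the expanded eleven-nomial ⇒ the rank-one pencil's determinant has `≤ 8` distinct positive roots. -/
theorem twoTwo_rankOne_le_eight_of_countP_le_nine (e d₀ d₁ d₂ d₃ : ℕ) (h01 : d₀ < d₁) (h1e : d₁ < e) (he2 : e < d₂) (h23 : d₂ < d₃)
    (w₀ w₁ w₂ w₃ t₀ t₁ t₂ t₃ : ℝ) (hw₀ : 0 < w₀) (hw₁ : 0 < w₁) (hw₂ : 0 < w₂) (hw₃ : 0 < w₃) (h01' : t₀ ≠ t₁) (h23' : t₂ ≠ t₃)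
    (h9 : (∑ i : Fin 11, Polynomial.C ((![(-1 : ℝ), w₀ * -(2 * t₀), w₁ * -(2 * t₁), w₂ * -(2 * t₂), w₃ * -(2 * t₃), w₀ * w₁ * (t₀ - t₁) ^ 2, w₀ * w₂ * (t₀ - t₂) ^ 2, w₀ * w₃ * (t₀ - t₃) ^ 2, w₁ * w₂ * (t₁ - t₂) ^ 2, w₁ * w₃ * (t₁ - t₃) ^ 2, w₂ * w₃ * (t₂ - t₃) ^ 2] : Fin 11 → ℝ) i) * X ^ ((![2 * e, e + d₀, e + d₁, e + d₂, e + d₃, d₀ + d₁, d₀ + d₂, d₀ + d₃, d₁ + d₂, d₁ + d₃, d₂ + d₃] : Fin 11 → ℕ) i)).roots.countP (fun x => 0 < x) ≤ 9) :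
    ((Matrix.det (((X : ℝ[X]) ^ e) • (!![(0 : ℝ), 1; 1, 0] : Matrix (Fin 2) (Fin 2) ℝ).map Polynomial.C
        + (Polynomial.C w₀ * X ^ d₀) • (vecMulVec ![1, t₀] ![1, t₀]).map Polynomial.C
        + (Polynomial.C w₁ * X ^ d₁) • (vecMulVec ![1, t₁] ![1, t₁]).map Polynomial.C
        + (Polynomial.C w₂ * X ^ d₂) • (vecMulVec ![1, t₂] ![1, t₂]).map Polynomial.C
        + (Polynomial.C w₃ * X ^ d₃) • (vecMulVec ![1, t₃] ![1, t₃]).map Polynomial.C)).roots.toFinset.filter (fun t => 0 < t)).card ≤ 8 := by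
  rw [det_rankOne_four_sum]
  have e0 : (!![(0 : ℝ), 1; 1, 0] : Matrix (Fin 2) (Fin 2) ℝ).det = -1 := by
    simp [Matrix.det_fin_two]
  have em : ∀ s r : ℝ, r * ((!![(0 : ℝ), 1; 1, 0] : Matrix (Fin 2) (Fin 2) ℝ) 0 0 * (![1, s] : Fin 2 → ℝ) 1 ^ 2
      + (!![(0 : ℝ), 1; 1, 0] : Matrix (Fin 2) (Fin 2) ℝ) 1 1 * (![1, s] : Fin 2 → ℝ) 0 ^ 2
      - ((!![(0 : ℝ), 1; 1, 0] : Matrix (Fin 2) (Fin 2) ℝ) 0 1 + (!![(0 : ℝ), 1; 1, 0] : Matrix (Fin 2) (Fin 2) ℝ) 1 0)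
        * ((![1, s] : Fin 2 → ℝ) 0 * (![1, s] : Fin 2 → ℝ) 1)) = r * -(2 * s) := by
    intro s r
    have : ((!![(0 : ℝ), 1; 1, 0] : Matrix (Fin 2) (Fin 2) ℝ) 0 0 * (![1, s] : Fin 2 → ℝ) 1 ^ 2
      + (!![(0 : ℝ), 1; 1, 0] : Matrix (Fin 2) (Fin 2) ℝ) 1 1 * (![1, s] : Fin 2 → ℝ) 0 ^ 2
      - ((!![(0 : ℝ), 1; 1, 0] : Matrix (Fin 2) (Fin 2) ℝ) 0 1 + (!![(0 : ℝ), 1; 1, 0] : Matrix (Fin 2) (Fin 2) ℝ) 1 0)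
        * ((![1, s] : Fin 2 → ℝ) 0 * (![1, s] : Fin 2 → ℝ) 1)) = -(2 * s) := by
      simp only [Matrix.of_apply, Matrix.cons_val', Matrix.cons_val_zero, Matrix.cons_val_one, Matrix.empty_val',
        Matrix.cons_val_fin_one]
      ring
    rw [this]
  have eD : ∀ s r c : ℝ, c * (((![1, s] : Fin 2 → ℝ) 0 * (![1, r] : Fin 2 → ℝ) 1 - (![1, s] : Fin 2 → ℝ) 1 * (![1, r] : Fin 2 → ℝ) 0) ^ 2)
      = c * (s - r) ^ 2 := by
    intro s r c
    have : ((![1, s] : Fin 2 → ℝ) 0 * (![1, r] : Fin 2 → ℝ) 1 - (![1, s] : Fin 2 → ℝ) 1 * (![1, r] : Fin 2 → ℝ) 0) ^ 2 = (s - r) ^ 2 := by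
      simp only [Matrix.cons_val_zero, Matrix.cons_val_one]
      ring
    rw [this]
  simp only [e0, em, eD]
  exact twoTwo_card_le_eight_of_countP_le_nine e d₀ d₁ d₂ d₃ h01 h1e he2 h23 w₀ w₁ w₂ w₃ t₀ t₁ t₂ t₃ hw₀ hw₁ hw₂ hw₃ h01' h23' h9

/-- **`2|2`, census currency**: `countP ≤ 9` for the expanded eleven-nomial of the letters `w k • (1, t k)(1, t k)ᵀ` ⇒
`pivotPosRoots e ![d₀, d₁, d₂, d₃] [[0,1],[1,0]] (letters) ≤ 8`. -/
theorem twoTwo_pivotPosRoots_le_eight_of_countP_le_nine (e d₀ d₁ d₂ d₃ : ℕ) (h01 : d₀ < d₁) (h1e : d₁ < e) (he2 : e < d₂)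
    (h23 : d₂ < d₃) (w t : Fin 4 → ℝ) (hw : ∀ k, 0 < w k) (h01' : t 0 ≠ t 1) (h23' : t 2 ≠ t 3)
    (h9 : (∑ i : Fin 11, Polynomial.C ((![(-1 : ℝ), w 0 * -(2 * t 0), w 1 * -(2 * t 1), w 2 * -(2 * t 2), w 3 * -(2 * t 3), w 0 * w 1 * (t 0 - t 1) ^ 2, w 0 * w 2 * (t 0 - t 2) ^ 2, w 0 * w 3 * (t 0 - t 3) ^ 2, w 1 * w 2 * (t 1 - t 2) ^ 2, w 1 * w 3 * (t 1 - t 3) ^ 2, w 2 * w 3 * (t 2 - t 3) ^ 2] : Fin 11 → ℝ) i) * X ^ ((![2 * e, e + d₀, e + d₁, e + d₂, e + d₃, d₀ + d₁, d₀ + d₂, d₀ + d₃, d₁ + d₂, d₁ + d₃, d₂ + d₃] : Fin 11 → ℕ) i)).roots.countP (fun x => 0 < x) ≤ 9) :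
    pivotPosRoots e (![d₀, d₁, d₂, d₃] : Fin 4 → ℕ) (!![(0 : ℝ), 1; 1, 0] : Matrix (Fin 2) (Fin 2) ℝ) (fun k => w k • vecMulVec ![1, t k] ![1, t k]) ≤ 8 := by
  unfold pivotPosRoots
  rw [pencil_four_unroll]
  have h := twoTwo_rankOne_le_eight_of_countP_le_nine e d₀ d₁ d₂ d₃ h01 h1e he2 h23 (w 0) (w 1) (w 2) (w 3) (t 0) (t 1) (t 2) (t 3)
    (hw 0) (hw 1) (hw 2) (hw 3) h01' h23' h9
  simpa using h

/-- **★ `2|2` CHORD FRAME**: if ten positive roots with multiplicity of the expanded eleven-nomial force the chord bounds on letters `1, 2, 3`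
(`KA·t₁t₂ ≤ (t₁−t₂)²`, `(t₂−t₃)² ≤ KB·t₂t₃`, `KC·(t₁−t₂)²t₃ ≤ (t₁−t₃)²t₂`) with constants under the side conditions of
`chord_contradiction_sharp`, then `pivotPosRoots ≤ 8` for those letters. -/
theorem twoTwo_pivotPosRoots_le_eight_of_chords (e d₀ d₁ d₂ d₃ : ℕ) (h01 : d₀ < d₁) (h1e : d₁ < e) (he2 : e < d₂) (h23 : d₂ < d₃)
    (KA KB KC R ρ : ℝ) (hKA : 0 < KA) (hR : 1 ≤ R) (hRA : (R - 1) ^ 2 ≤ KA * R) (hρ : 1 ≤ ρ) (hρB : KB * ρ ≤ (ρ - 1) ^ 2)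
    (hρR : ρ ≤ R) (hKC : ρ * R ^ 2 < KC * (R - 1) ^ 2)
    (w t : Fin 4 → ℝ) (hw : ∀ k, 0 < w k) (ht₁ : 0 < t 1) (ht₂ : 0 < t 2) (ht₃ : 0 < t 3) (h01' : t 0 ≠ t 1) (h23' : t 2 ≠ t 3)
    (hch : 10 ≤ (∑ i : Fin 11, Polynomial.C ((![(-1 : ℝ), w 0 * -(2 * t 0), w 1 * -(2 * t 1), w 2 * -(2 * t 2), w 3 * -(2 * t 3), w 0 * w 1 * (t 0 - t 1) ^ 2, w 0 * w 2 * (t 0 - t 2) ^ 2, w 0 * w 3 * (t 0 - t 3) ^ 2, w 1 * w 2 * (t 1 - t 2) ^ 2, w 1 * w 3 * (t 1 - t 3) ^ 2, w 2 * w 3 * (t 2 - t 3) ^ 2] : Fin 11 → ℝ) i) * X ^ ((![2 * e, e + d₀, e + d₁, e + d₂, e + d₃, d₀ + d₁, d₀ + d₂, d₀ + d₃, d₁ + d₂, d₁ + d₃, d₂ + d₃] : Fin 11 → ℕ) i)).roots.countP (fun x => 0 < x) →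
      KA * (t 1 * t 2) ≤ (t 1 - t 2) ^ 2 ∧ (t 2 - t 3) ^ 2 ≤ KB * (t 2 * t 3) ∧ KC * ((t 1 - t 2) ^ 2 * t 3) ≤ (t 1 - t 3) ^ 2 * t 2) :
    pivotPosRoots e (![d₀, d₁, d₂, d₃] : Fin 4 → ℕ) (!![(0 : ℝ), 1; 1, 0] : Matrix (Fin 2) (Fin 2) ℝ) (fun k => w k • vecMulVec ![1, t k] ![1, t k]) ≤ 8 := by
  refine twoTwo_pivotPosRoots_le_eight_of_countP_le_nine e d₀ d₁ d₂ d₃ h01 h1e he2 h23 w t hw h01' h23' ?_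
  by_contra h10
  push Not at h10
  obtain ⟨hA, hB, hC⟩ := hch (by omega)
  exact chord_contradiction_sharp (t 1) (t 2) (t 3) KA KB KC R ρ ht₁ ht₂ ht₃ hKA hR hRA hρ hρB hρR hKC hA hB hC

end Summit.ValiantsHypothesis.ValiantsHypothesis.Theorems.LacunarySymmetroidMatrixDescartes.Pivot.TwoDirections.BlockLaw
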